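import Literature.AlgebraicGeometry.HodgeTheory.QuaternionicQuarticGenericModelOfLifting
import Literature.AlgebraicGeometry.Resolution.KollarConclusionOfMinimalResolution
import HarnessLib

/-!
# The generic smooth projective `Q₈`-model from MINIMAL RESOLUTIONS of surfaces (programme «M1», brick M1-4a)

Layer `Literature/AlgebraicGeometry/HodgeTheory`. One theorem (no named fact, no definition). Route
`HodgeConjecture/Q8SymplecticPowers` (crux K1Q, stmt-HodgeConjecture-24190): the brick
`Q8Family.exists_genericModel` needs Kollár's lifting fact only at integral projective SURFACES over
`K = Frac ℂ[a]` (`exists_genericModel_of_surfaceLifting`), and that instance follows from the existence of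
minimal resolutions with projective source (`Resolution.exists_actionOver_of_isMinimalResolution_of_isProjectiveOver`:
automorphisms lift to a minimal resolution by its universal property, and a minimal resolution is an isomorphism
over the regular locus). Hence:

* `exists_genericModel_of_minimalResolutions` — IF every integral projective `K`-scheme of dimension `2` has a
  minimal resolution (universal property `IsMinimalResolution`) whose source is projective over `K`, THEN the
  generic smooth projective `Q₈`-model exists (conclusion of `exists_genericModel`, Kollár-free).

The hypothesis is Bădescu 2001 Thm. 4.3 ∕ Prop. 4.5 (existence and universal property of the minimal
desingularization of a surface; Lipman 1969 §27) — a theorem about surfaces only, not yet in the tree.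

Honest scope: a reduction; nothing here bears on HC.

## References

* [Badescu2001] L. Bădescu, Algebraic Surfaces (2001), Thm. 4.3, Def. 4.4, Prop. 4.5.
* [Kollar2007] J. Kollár, Lectures on Resolution of Singularities (2007), Thm. 3.36, §3.4.1 (p. 121).
* [DeJong1996] A. J. de Jong, Smoothness, semi-stability and alterations (1996), 4.17.
-/

noncomputable section

open CategoryTheory CategoryTheory.Limits AlgebraicGeometry TopologicalSpace

namespace Literature.AlgebraicGeometry.HodgeTheory.Q8Family

open Literature.AlgebraicGeometry.Motives Literature.AlgebraicGeometry.RelativeSpec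
  Literature.AlgebraicGeometry.Resolution

/-- **The generic smooth projective `Q₈`-model from minimal resolutions of surfaces.** Let `K = Frac ℂ[a]` and
`e ≥ 2`. If every integral projective `K`-scheme of dimension `2` admits a minimal resolution (every resolution
factors through it) with source projective over `K`, then there is a smooth projective geometrically irreducible
`K`-surface `E` with a `Q₈`-action and a `Q₈`-equivariant open immersion `genericChart e K ↪ E` over `K`.
[cite: Badescu2001, Thm. 4.3 and Prop. 4.5] [cite: Kollar2007, Thm. 3.36 and §3.4.1 (p. 121)] [cite: DeJong1996, 4.17, p. 72] -/
theorem exists_genericModel_of_minimalResolutions (e : ℕ) (he : 2 ≤ e)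
    (H : ∀ (N : SchemeOver (FractionRing (ParamRing e))) [IsIntegral N.left], IsProjectiveOver N →
      topologicalKrullDim N.left = (2 : ℕ) →
      ∃ (Y : Scheme) (r : Y ⟶ N.left), IsMinimalResolution r ∧ IsProjectiveOver (Over.mk (r ≫ N.hom))) :
    ∃ (E : SchemeOver (FractionRing (ParamRing e))) (ρE : ActionOver E.hom (QuaternionGroup 2))
      (θ : genericChart e (FractionRing (ParamRing e)) ⟶ E),
      IsSmoothProjective 2 E ∧ IsOpenImmersion θ.left ∧
      ∀ g : QuaternionGroup 2,
        ((genericAction e (FractionRing (ParamRing e))).aut g).hom ≫ θ.left = θ.left ≫ (ρE.aut g).hom := by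
  haveI : CharZero (FractionRing (ParamRing e)) :=
    charZero_of_injective_algebraMap (IsFractionRing.injective (ParamRing e) (FractionRing (ParamRing e)))
  refine exists_genericModel_of_surfaceLifting e he fun N _ hN h2 ρN => ?_
  obtain ⟨Y, r, hmin, hproj⟩ := H N hN h2
  exact exists_actionOver_of_isMinimalResolution_of_isProjectiveOver N hN hmin hproj ρN

end Literature.AlgebraicGeometry.HodgeTheory.Q8Family

end
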